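import Literature.Computation.Certificates.PsdRoundedTwinPacked

/-!
# Rounded-twin PSD lane on a DIAGONALLY EQUILIBRATED block (power-of-two congruence)

Compute-infrastructure file (certnum L4, 2026-08-27; companion of `PsdRoundedTwinPacked.lean`).
A rational Gram block `Q` whose diagonal spans many binades (gridfusion #50's 189-block:
`Q_aa ∈ [7.8·10⁻⁶, 25]`, float `λ_min(Q) ≈ 7.8·10⁻⁶ ≈ min_a Q_aa`) has an unnecessarily HEAVY rounded
twin: the twin scale `S = 2^K` must resolve `λ_min(Q)` (`K = 27`), the DD factor needs `b = 14`
fractional bits, entries reach 60 bits, factor digits 30 bits (830 844 hex characters of data for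
that block, 7 files at the gate's byte cap). The classical cure is DIAGONAL EQUILIBRATION by a
power-of-two congruence `D = diag(2^{c_a})`, `c_a ≈ −½·log₂ Q_aa` (error-free even in floating
point, which is why verified-PD routines apply it first): `Q' = D Q D` has near-unit diagonal,
`λ_min(Q') ≈ 5·10⁻²` for the same block, and its twin needs `K = 14`, `b = 6`, 27-bit entries,
14-bit factor digits — 393 222 hex characters (−53 %), 4 files, and a cheaper DD walk.
Soundness is Sylvester's observation that congruence preserves positive semidefiniteness
[cite: HornJohnson2013, Obs. 7.1.8]: `yᵀ Q y = zᵀ (DQD) z` with `z = D⁻¹ y`.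

This file supplies: `PSD.scaleRows2 cs cs Qrows` — the rows of `D Q D` COMPUTED IN THE KERNEL from
the client's rows (structural recursion, one `ℚ`-by-`2^k` product per entry, evaluated lazily by
`PSD.closeRangeP`; no scaled data is shipped) and its semantics `PSD.matrixOfRows_scaleRows2`;
the congruence step `PSD.quadForm_nonneg_of_diagScaled`; the twin-lane entry points
`PSD.quadForm_nonneg_of_packedTwinRows_ranges_scaled` / `…_covers_scaled` (closeness of the
SCALED rows to the packed twin of `D Q D`, conclusion for `Q` itself); and at `SOS.GramL` level
both the one-term emitted shapes `quadNonneg_of_packedTwinRows_ranges_scaled` / `…_covers_scaled`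
and the lane-agnostic transfer `quadNonneg_of_scaled2` (ANY PSD lane run on the block
`⟨basis, scaleRows2 cs cs Q, [], []⟩` yields `QuadNonneg` of the original block).
[cite: Rump1999VerifiedLargeSystems, §4 Algorithm 4.1 step 7; HornJohnson2013, Obs. 7.1.8]

WHAT THIS FILE DOES NOT CERTIFY: a good choice of exponents `cs` (any list is SOUND; a bad one only
makes the twin heavier or non-existent); existence of a twin; anything beyond `QuadNonneg` of the
block; the identity side.
-/

namespace Literature.Computation.Certificates

namespace PSD

/-! ### The scaled rows, computed in the kernel -/

/-- One row of `D Q D`: entry `j` of row `i` is `q_ij · 2^(c_i + c_j)`, walking the row together with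
the exponent list (`c_j = csj.headD 0`; a missing exponent reads as `0`). Structural recursion on
the row (no `Array` accumulators, so kernel evaluation is one cons per entry). [folklore] -/
def scaleRow2 (ci : ℕ) : List ℕ → List ℚ → List ℚ
  | _, [] => []
  | csj, q :: qs => (q * 2 ^ (ci + csj.headD 0)) :: scaleRow2 ci csj.tail qs

/-- The rows of `D Q D`, `D = diag(2^{c_i})`: `scaleRows2 cs csi rows` scales row `i` by
`c_i = csi.headD 0` (walking `csi`) against the full exponent list `cs`; use `scaleRows2 cs cs Qrows`.
[cite: HornJohnson2013, Obs. 7.1.8] -/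
def scaleRows2 (cs : List ℕ) : List ℕ → List (List ℚ) → List (List ℚ)
  | _, [] => []
  | csi, row :: rows => scaleRow2 (csi.headD 0) cs row :: scaleRows2 cs csi.tail rows

/-- Entry semantics of `scaleRow2` (out-of-range entries are `0` on both sides). [folklore] -/
private theorem getD_scaleRow2 (ci : ℕ) (csj : List ℕ) (row : List ℚ) (j : ℕ) :
    (scaleRow2 ci csj row).getD j 0 = row.getD j 0 * 2 ^ (ci + csj.getD j 0) := by
  induction row generalizing csj j with
  | nil => simp [scaleRow2]
  | cons q qs ih =>
    cases j with
    | zero => cases csj <;> simp [scaleRow2]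
    | succ j =>
      cases csj with
      | nil => simp only [scaleRow2, List.getD_cons_succ, List.tail_nil, ih, List.getD_nil]
      | cons c cs' => simp only [scaleRow2, List.getD_cons_succ, List.tail_cons, ih]

/-- Row semantics of `scaleRows2` (out-of-range rows are `[]` on both sides). [folklore] -/
private theorem getD_scaleRows2 (cs csi : List ℕ) (rows : List (List ℚ)) (i : ℕ) :
    (scaleRows2 cs csi rows).getD i [] = scaleRow2 (csi.getD i 0) cs (rows.getD i []) := by
  induction rows generalizing csi i with
  | nil => simp [scaleRows2, scaleRow2]
  | cons row rows ih =>
    cases i with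
    | zero => cases csi <;> simp [scaleRows2]
    | succ i =>
      cases csi with
      | nil => simp only [scaleRows2, List.getD_cons_succ, List.tail_nil, ih, List.getD_nil]
      | cons c cs' => simp only [scaleRows2, List.getD_cons_succ, List.tail_cons, ih]

/-- **`scaleRows2 cs cs Qrows` are the rows of `D Q D`**: as matrices,
`(D Q D) i j = Q i j · 2^(c_i + c_j)` with `c_i = cs.getD i 0`. [cite: HornJohnson2013, Obs. 7.1.8] -/
theorem matrixOfRows_scaleRows2 {m n : ℕ} (cs : List ℕ) (Qrows : List (List ℚ))
    (i : Fin m) (j : Fin n) :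
    matrixOfRows m n (scaleRows2 cs cs Qrows) i j =
      matrixOfRows m n Qrows i j * 2 ^ (cs.getD i.val 0 + cs.getD j.val 0) := by
  simp only [matrixOfRows_apply, getD_scaleRows2, getD_scaleRow2]

/-! ### Congruence by a nonsingular diagonal preserves the nonnegative quadratic form -/

section Congruence

variable {R : Type*} [Field R] [LinearOrder R] [IsStrictOrderedRing R]

omit [IsStrictOrderedRing R] in
/-- **Sylvester / congruence step for a diagonal**: if the quadratic form of `D Q D`
(`(DQD) i j = Q i j · (c_i c_j)`, all `c_i ≠ 0`) is nonnegative then so is that of `Q`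
(evaluate at `z = D⁻¹ y`). [cite: HornJohnson2013, Obs. 7.1.8] -/
theorem quadForm_nonneg_of_diagScaled {n : ℕ} (Q : Matrix (Fin n) (Fin n) R) (c : Fin n → R)
    (hc : ∀ i, c i ≠ 0)
    (h : ∀ z : Fin n → R, 0 ≤ ∑ i, ∑ j, z i * (Q i j * (c i * c j)) * z j) (y : Fin n → R) :
    0 ≤ ∑ i, ∑ j, y i * Q i j * y j := by
  refine (h fun i => y i / c i).trans_eq
    (Finset.sum_congr rfl fun i _ => Finset.sum_congr rfl fun j _ => ?_)
  have hi := hc i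
  have hj := hc j
  field_simp

end Congruence

/-! ### The twin lane run on the scaled rows, conclusion for the original block -/

section TwinScaled

variable {R : Type*} [Field R] [LinearOrder R] [IsStrictOrderedRing R]

/-- **Rounded twin of `D Q D` shipped as PACKED rows, closeness in row ranges against the SCALED
rows** (`closeRangeP … (scaleRows2 cs cs Qrows) Arows`, the scaling done in the kernel), packed DD
certificate of the twin, margin ⇒ the nonnegative quadratic form of `Q = matrixOfRows n n Qrows`
itself. [cite: Rump1999VerifiedLargeSystems, §4 Algorithm 4.1 step 7; HornJohnson2013, Obs. 7.1.8] -/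
theorem quadForm_nonneg_of_packedTwinRows_ranges_scaled {n w den v x O S s e k mch : ℕ}
    {Qrows : List (List ℚ)} {cs Arows ds Crows : List ℕ}
    (hcheck : Packed.checkRows n w den v x O Arows ds Crows = true) (hS : 0 < S)
    (hranges : ∀ c : Fin mch,
      closeRangeP n w S s e (c.val * k) k (scaleRows2 cs cs Qrows) Arows = true)
    (hcover : n ≤ mch * k) (hmargin : n * e ≤ s) (y : Fin n → R) :
    0 ≤ ∑ i, ∑ j, y i * ((matrixOfRows n n Qrows i j : ℚ) : R) * y j := by
  refine quadForm_nonneg_of_diagScaled _ (fun i => (2 : R) ^ cs.getD i.val 0)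
    (fun i => pow_ne_zero _ two_ne_zero) (fun z => ?_) y
  refine (quadForm_nonneg_of_packedTwinRows_ranges (R := R) hcheck hS hranges hcover hmargin z).trans_eq
    (Finset.sum_congr rfl fun i _ => Finset.sum_congr rfl fun j _ => ?_)
  rw [matrixOfRows_scaleRows2]
  push_cast
  ring

/-- **Rounded twin of `D Q D`, packed rows, closeness ranges of ANY widths** (`CloseRangesP` on
the scaled rows) ⇒ the nonnegative quadratic form of `Q`.
[cite: Rump1999VerifiedLargeSystems, §4 Algorithm 4.1 step 7; HornJohnson2013, Obs. 7.1.8] -/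
theorem quadForm_nonneg_of_packedTwinRows_covers_scaled {n w den v x O S s e : ℕ}
    {Qrows : List (List ℚ)} {cs Arows ds Crows cnts : List ℕ}
    (hcheck : Packed.checkRows n w den v x O Arows ds Crows = true) (hS : 0 < S)
    (hclose : CloseRangesP n w S s e (scaleRows2 cs cs Qrows) Arows 0 cnts) (hcover : n ≤ cnts.sum)
    (hmargin : n * e ≤ s) (y : Fin n → R) :
    0 ≤ ∑ i, ∑ j, y i * ((matrixOfRows n n Qrows i j : ℚ) : R) * y j := by
  refine quadForm_nonneg_of_diagScaled _ (fun i => (2 : R) ^ cs.getD i.val 0)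
    (fun i => pow_ne_zero _ two_ne_zero) (fun z => ?_) y
  refine (quadForm_nonneg_of_packedTwinRows_covers (R := R) hcheck hS hclose hcover hmargin z).trans_eq
    (Finset.sum_congr rfl fun i _ => Finset.sum_congr rfl fun j _ => ?_)
  rw [matrixOfRows_scaleRows2]
  push_cast
  ring

end TwinScaled

end PSD

namespace SOS

namespace GramL

variable {R : Type*} [Field R] [LinearOrder R] [IsStrictOrderedRing R]

/-- **Lane-agnostic equilibration transfer**: `QuadNonneg` of the SCALED list block
`⟨g.basis, scaleRows2 cs cs g.Q, [], []⟩` (obtained by ANY PSD lane — twin, exact packed, `ℤ`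
lists) gives `QuadNonneg` of `g`. [cite: HornJohnson2013, Obs. 7.1.8] -/
theorem quadNonneg_of_scaled2 (g : GramL) (cs : List ℕ)
    (h : (⟨g.basis, PSD.scaleRows2 cs cs g.Q, [], []⟩ : GramL).toGramSOS.QuadNonneg R) :
    g.toGramSOS.QuadNonneg R := by
  refine g.quadNonneg_of_quadForm fun y => ?_
  refine PSD.quadForm_nonneg_of_diagScaled _ (fun i => (2 : R) ^ cs.getD i.val 0)
    (fun i => pow_ne_zero _ two_ne_zero) (fun z => ?_) y
  have hz : 0 ≤ ∑ a, ∑ b, z a * z b *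
      ((matrixOfRows g.s g.s (PSD.scaleRows2 cs cs g.Q) a b : ℚ) : R) := h z
  refine hz.trans_eq (Finset.sum_congr rfl fun i _ => Finset.sum_congr rfl fun j _ => ?_)
  rw [PSD.matrixOfRows_scaleRows2]
  push_cast
  ring

/-- **Twin lane on the equilibrated block, PACKED twin rows, chunked closeness** — the emitters'
one-term shape: packed DD certificate of the twin of `D Q D` (one decide), `mch` ranges of
`PSD.closeRangeP` against `PSD.scaleRows2 cs cs g.Q` (scaling in the kernel), margin ⇒
`QuadNonneg` of `g`. [cite: Rump1999VerifiedLargeSystems, §4 Algorithm 4.1 step 7; HornJohnson2013, Obs. 7.1.8] -/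
theorem quadNonneg_of_packedTwinRows_ranges_scaled (g : GramL) {w den v x O S s e k mch : ℕ}
    {cs Arows ds Crows : List ℕ}
    (hcheck : PSD.Packed.checkRows g.s w den v x O Arows ds Crows = true) (hS : 0 < S)
    (hranges : ∀ c : Fin mch,
      PSD.closeRangeP g.s w S s e (c.val * k) k (PSD.scaleRows2 cs cs g.Q) Arows = true)
    (hcover : g.s ≤ mch * k) (hmargin : g.s * e ≤ s) :
    g.toGramSOS.QuadNonneg R :=
  g.quadNonneg_of_quadForm fun y =>
    PSD.quadForm_nonneg_of_packedTwinRows_ranges_scaled hcheck hS hranges hcover hmargin y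

/-- **Twin lane on the equilibrated block, PACKED twin rows, closeness ranges of any widths.**
[cite: Rump1999VerifiedLargeSystems, §4 Algorithm 4.1 step 7; HornJohnson2013, Obs. 7.1.8] -/
theorem quadNonneg_of_packedTwinRows_covers_scaled (g : GramL) {w den v x O S s e : ℕ}
    {cs Arows ds Crows cnts : List ℕ}
    (hcheck : PSD.Packed.checkRows g.s w den v x O Arows ds Crows = true) (hS : 0 < S)
    (hclose : PSD.CloseRangesP g.s w S s e (PSD.scaleRows2 cs cs g.Q) Arows 0 cnts)
    (hcover : g.s ≤ cnts.sum) (hmargin : g.s * e ≤ s) :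
    g.toGramSOS.QuadNonneg R :=
  g.quadNonneg_of_quadForm fun y =>
    PSD.quadForm_nonneg_of_packedTwinRows_covers_scaled hcheck hS hclose hcover hmargin y

end GramL

end SOS

/-! ### Kernel smoke test
The `2 × 2` block `Q = D⁻¹ Q₀ D⁻¹`, `D = diag(2, 1)`, of the packed example `Q₀` of
`PsdRoundedTwinPacked.lean`: with exponents `cs = [1, 0]` the kernel recomputes `Q₀ = D Q D` inside
`closeRangeP` and the SAME twin data certifies `Q`. -/

namespace SOS

example : (GramL.toGramSOS ⟨[[1, 0], [0, 1]],
      [[((2 : ℚ) + 1 / 3 ^ 40) / 4, -1 / 2], [-1 / 2, (2 : ℚ) - 1 / 3 ^ 40]], [], []⟩).QuadNonneg ℝ :=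
  GramL.quadNonneg_of_packedTwinRows_covers_scaled _ (w := 4) (den := 1) (v := 3) (x := 8) (O := 3)
    (S := 4) (s := 2) (e := 1) (cs := [1, 0]) (Arows := [78, 228]) (ds := [1, 1])
    (Crows := [[2, 0], [-2, 1]].map (PSD.Packed.packCol 3 3)) (cnts := [1, 1])
    (by decide +kernel) (by decide) ⟨by decide +kernel, by decide +kernel, trivial⟩ (by decide) (by decide)

example : (GramL.toGramSOS ⟨[[1, 0], [0, 1]],
      [[((2 : ℚ) + 1 / 3 ^ 40) / 4, -1 / 2], [-1 / 2, (2 : ℚ) - 1 / 3 ^ 40]], [], []⟩).QuadNonneg ℝ :=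
  GramL.quadNonneg_of_packedTwinRows_ranges_scaled _ (w := 4) (den := 1) (v := 3) (x := 8) (O := 3)
    (S := 4) (s := 2) (e := 1) (k := 1) (mch := 2) (cs := [1, 0]) (Arows := [78, 228]) (ds := [1, 1])
    (Crows := [[2, 0], [-2, 1]].map (PSD.Packed.packCol 3 3))
    (by decide +kernel) (by decide) (by intro c; fin_cases c <;> decide +kernel) (by decide) (by decide)

end SOS

end Literature.Computation.Certificates

/-! ## General split shapes (APPEND 2026-08-27, certnum-sdp-3 g6): DD check in ROW RANGES and closeness
ranges of ANY widths, plain and equilibrated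

The shape for blocks whose one-decide packed DD walk (`∝ n³` digit products: 33 s at `n = 189`,
14-bit digits) or whose closeness pass exceeds a per-file kernel budget (`n ≳ 300` at 150 s): the
packed DD certificate split as `PSD.Packed.checkRowsHead` + `PSD.Packed.RangesOK` (one
`checkRowsRange` decide per file, `PackedGramCertificateRows.lean` p510008), the closeness as
`PSD.CloseRangesP` (consecutive ranges of any widths — no `k ∣ n` constraint, no phantom rows),
assembled by `⟨h₀, h₁, …, trivial⟩`; conclusion for the ORIGINAL rows in both the plain and the
equilibrated (`PSD.scaleRows2`) variants. [cite: Rump1999VerifiedLargeSystems, §4 Algorithm 4.1 step 7;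
HornJohnson2013, Obs. 7.1.8] -/

namespace Literature.Computation.Certificates

namespace PSD

section SplitCovers

variable {R : Type*} [Field R] [LinearOrder R] [IsStrictOrderedRing R]

/-- **Rounded twin, PACKED rows, DD check split in row ranges, closeness ranges of any widths**:
`checkRowsHead` + `RangesOK … 0 cnts` (`n ≤ Σ cnts`) + `CloseRangesP … Qrows Arows 0 ccnts`
(`n ≤ Σ ccnts`) + margin ⇒ the nonnegative quadratic form of `matrixOfRows n n Qrows`.
[cite: Rump1999VerifiedLargeSystems, §4 Algorithm 4.1 step 7] -/
theorem quadForm_nonneg_of_packedTwinRows_split_covers {n w den v x O S s e : ℕ}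
    {Qrows : List (List ℚ)} {Arows ds Crows cnts ccnts : List ℕ}
    (hhead : Packed.checkRowsHead n w den v x O Arows ds Crows = true)
    (hrows : Packed.RangesOK w v x O Arows ds Crows 0 cnts) (hcnts : n ≤ cnts.sum) (hS : 0 < S)
    (hclose : CloseRangesP n w S s e Qrows Arows 0 ccnts) (hccov : n ≤ ccnts.sum)
    (hmargin : n * e ≤ s) (y : Fin n → R) :
    0 ≤ ∑ i, ∑ j, y i * ((matrixOfRows n n Qrows i j : ℚ) : R) * y j :=
  quadForm_nonneg_of_twinMatrix_of_close (Packed.isGramCertZ_of_checkRowsRanges hhead hrows hcnts) hS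
    (fun i j => closeRangesP_spec ccnts 0 hclose i j (Nat.zero_le _) (by have := i.isLt; omega))
    hmargin y

/-- **Equilibrated twin, PACKED rows, DD check split in row ranges, closeness ranges of any widths
against the SCALED rows** `scaleRows2 cs cs Qrows` ⇒ the nonnegative quadratic form of the ORIGINAL
`matrixOfRows n n Qrows`. [cite: Rump1999VerifiedLargeSystems, §4 Algorithm 4.1 step 7; HornJohnson2013, Obs. 7.1.8] -/
theorem quadForm_nonneg_of_packedTwinRows_split_covers_scaled {n w den v x O S s e : ℕ}
    {Qrows : List (List ℚ)} {cs Arows ds Crows cnts ccnts : List ℕ}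
    (hhead : Packed.checkRowsHead n w den v x O Arows ds Crows = true)
    (hrows : Packed.RangesOK w v x O Arows ds Crows 0 cnts) (hcnts : n ≤ cnts.sum) (hS : 0 < S)
    (hclose : CloseRangesP n w S s e (scaleRows2 cs cs Qrows) Arows 0 ccnts) (hccov : n ≤ ccnts.sum)
    (hmargin : n * e ≤ s) (y : Fin n → R) :
    0 ≤ ∑ i, ∑ j, y i * ((matrixOfRows n n Qrows i j : ℚ) : R) * y j := by
  refine quadForm_nonneg_of_diagScaled _ (fun i => (2 : R) ^ cs.getD i.val 0)
    (fun i => pow_ne_zero _ two_ne_zero) (fun z => ?_) y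
  refine (quadForm_nonneg_of_packedTwinRows_split_covers (R := R) hhead hrows hcnts hS hclose hccov
    hmargin z).trans_eq (Finset.sum_congr rfl fun i _ => Finset.sum_congr rfl fun j _ => ?_)
  rw [matrixOfRows_scaleRows2]
  push_cast
  ring

end SplitCovers

end PSD

namespace SOS

namespace GramL

variable {R : Type*} [Field R] [LinearOrder R] [IsStrictOrderedRing R]

/-- **Twin lane, everything split, any widths** (plain rows): `checkRowsHead` + `RangesOK` +
`CloseRangesP` + margin ⇒ `QuadNonneg`. [cite: Rump1999VerifiedLargeSystems, §4 Algorithm 4.1 step 7] -/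
theorem quadNonneg_of_packedTwinRows_split_covers (g : GramL) {w den v x O S s e : ℕ}
    {Arows ds Crows cnts ccnts : List ℕ}
    (hhead : PSD.Packed.checkRowsHead g.s w den v x O Arows ds Crows = true)
    (hrows : PSD.Packed.RangesOK w v x O Arows ds Crows 0 cnts) (hcnts : g.s ≤ cnts.sum) (hS : 0 < S)
    (hclose : PSD.CloseRangesP g.s w S s e g.Q Arows 0 ccnts) (hccov : g.s ≤ ccnts.sum)
    (hmargin : g.s * e ≤ s) : g.toGramSOS.QuadNonneg R :=
  g.quadNonneg_of_quadForm fun y =>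
    PSD.quadForm_nonneg_of_packedTwinRows_split_covers hhead hrows hcnts hS hclose hccov hmargin y

/-- **Twin lane on the EQUILIBRATED block, everything split, any widths**: `checkRowsHead` +
`RangesOK` of the twin of `D Q D` + `CloseRangesP` against `PSD.scaleRows2 cs cs g.Q` + margin ⇒
`QuadNonneg` of `g`. [cite: Rump1999VerifiedLargeSystems, §4 Algorithm 4.1 step 7; HornJohnson2013, Obs. 7.1.8] -/
theorem quadNonneg_of_packedTwinRows_split_covers_scaled (g : GramL) {w den v x O S s e : ℕ}
    {cs Arows ds Crows cnts ccnts : List ℕ}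
    (hhead : PSD.Packed.checkRowsHead g.s w den v x O Arows ds Crows = true)
    (hrows : PSD.Packed.RangesOK w v x O Arows ds Crows 0 cnts) (hcnts : g.s ≤ cnts.sum) (hS : 0 < S)
    (hclose : PSD.CloseRangesP g.s w S s e (PSD.scaleRows2 cs cs g.Q) Arows 0 ccnts)
    (hccov : g.s ≤ ccnts.sum) (hmargin : g.s * e ≤ s) : g.toGramSOS.QuadNonneg R :=
  g.quadNonneg_of_quadForm fun y =>
    PSD.quadForm_nonneg_of_packedTwinRows_split_covers_scaled hhead hrows hcnts hS hclose hccov hmargin y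

/-- Test (plain, everything split): the `2 × 2` packed example with DD row ranges `[1, 1]` and
closeness cover `[2]`. -/
example : (GramL.toGramSOS ⟨[[1, 0], [0, 1]],
      [[(2 : ℚ) + 1 / 3 ^ 40, -1], [-1, (2 : ℚ) - 1 / 3 ^ 40]], [], []⟩).QuadNonneg ℝ :=
  GramL.quadNonneg_of_packedTwinRows_split_covers _ (w := 4) (den := 1) (v := 3) (x := 8) (O := 3)
    (S := 4) (s := 2) (e := 1) (Arows := [78, 228]) (ds := [1, 1])
    (Crows := [[2, 0], [-2, 1]].map (PSD.Packed.packCol 3 3)) (cnts := [1, 1]) (ccnts := [2])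
    (by decide +kernel) ⟨by decide +kernel, by decide +kernel, trivial⟩ (by decide) (by decide)
    ⟨by decide +kernel, trivial⟩ (by decide) (by decide)

/-- Test (equilibrated, everything split): `Q = D⁻¹ Q₀ D⁻¹`, `D = diag(2, 1)`, `cs = [1, 0]`, the same
twin data, DD row ranges `[1, 1]`, closeness cover `[1, 1]`. -/
example : (GramL.toGramSOS ⟨[[1, 0], [0, 1]],
      [[((2 : ℚ) + 1 / 3 ^ 40) / 4, -1 / 2], [-1 / 2, (2 : ℚ) - 1 / 3 ^ 40]], [], []⟩).QuadNonneg ℝ :=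
  GramL.quadNonneg_of_packedTwinRows_split_covers_scaled _ (w := 4) (den := 1) (v := 3) (x := 8)
    (O := 3) (S := 4) (s := 2) (e := 1) (cs := [1, 0]) (Arows := [78, 228]) (ds := [1, 1])
    (Crows := [[2, 0], [-2, 1]].map (PSD.Packed.packCol 3 3)) (cnts := [1, 1]) (ccnts := [1, 1])
    (by decide +kernel) ⟨by decide +kernel, by decide +kernel, trivial⟩ (by decide) (by decide)
    ⟨by decide +kernel, by decide +kernel, trivial⟩ (by decide) (by decide)

end GramL

end SOS

end Literature.Computation.Certificates
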